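import Literature.NumberTheory.EllipticCurves.Sprung2017.HalfLogarithmMatrixInvolutionProofs
import HarnessLib

/-!
# Sprung 2017, §3.4 (Prop. 3.14) at `(p, a_p) = (3, 3b)`, MOD 3: the integral transition matrix `M` of
# `ℒ(T) = M(T)·ℒ(T^ι)` is DIAGONAL modulo `3` and `≡ 1` modulo `T` — proofs only

A *proofs* companion (theorems only; no definition, no named fact) of `HalfLogarithmMatrixInvolutionProofs` (p634584:
`ℒ = M·ℒ(T^ι)` with `M ∈ M₂(ℤ_3⟦T⟧)`; ℒ = `halfLogMatrix b`, `ι = (1+T)⁻¹ − 1`).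

## What is proved

Because `a_3 = 3b ≡ 0 (mod 3)`, the rows of the partial products `𝒞_1⋯𝒞_n` alternate modulo `3`: `u_{2m} ≡ 0`,
`v_{2m+1} ≡ 0 (mod 3)` (`three_dvd_sharpPoly_two_mul`, `three_dvd_flatPoly_two_mul_add_one`), so the off-diagonal entries
`T·g·u_n u_{n+1}`, `−T·g·v_n v_{n+1}` of the twist factors `E_{n+1}` are divisible by `3`, and all `E_{n+1} ≡ 1 (mod T)`.
Carrying these invariants through the induction and the compactness limit of the previous file:

* `exists_twistMatrix_rowSeq_modThree` / `exists_twistMatrix_halfLogApprox_modThree` — the integer twist matrices `M_n` can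
  be taken with `3 ∣ (M_n)_{01}, (M_n)_{10}` and `(M_n)_{00}(0) = (M_n)_{11}(0) = 1`;
* **`exists_integral_halfLogMatrix_eq_mul_subst_modThree`** — there is `M ∈ M₂(ℤ_3⟦T⟧)` with `ℒ = M·ℒ(T^ι)`, every
  coefficient of `M_{01}` and `M_{10}` divisible by `3`, and `M_{00}(0) = M_{11}(0) = 1`.

CONSUMER (Summits side, crux `SprungLowerDivisibilityAtThree`, line `chromatic-common-zeros`): MOD 3 THE TWO COLOURS DECOUPLE
under `ι` — `κ′·L♯(T^ι) ≡ m·L♯ (mod 3Λ)` with `m(0) = 1` — whence the parity theorem `(−1)^{λ(L^•)} = σ` (the Fricke sign) for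
every colour with `μ = 0`, in particular `λ(L♯) ≡ λ(L♭) (mod 2)`. HONEST FRAMING: elementary algebra about the tree's own
definitions; special case `p = 3`; nothing about any curve; BSD is not proved by any of this.

References: [Sprung2017] §3.1, §3.4 Prop. 3.14, Cor. 4.4; [GreenbergLNM1716] §1.
-/

noncomputable section

open scoped MatrixGroups

open Polynomial Filter Topology Literature.Barriers.BirchSwinnertonDyer

namespace Literature.NumberTheory.EllipticCurves.Sprung2017

/-! ## §1 Parity of the rows of `𝒞_1⋯𝒞_n` modulo `3` (`a = 3b`) -/

section Parity

/-- `u_{2m} ∈ 3·ℤ[T]` for `a = 3b` (`u_0 = 0`, `u_{n+2} = 3b·u_{n+1} − Φ·u_n`). [cite: Sprung2017, Cor. 4.4] -/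
theorem three_dvd_sharpPoly_two_mul (b : ℤ) (m : ℕ) : (C 3 : ℤ[X]) ∣ sharpPoly (3 * b) 3 (2 * m) := by
  induction m with
  | zero => simp
  | succ m ih =>
    rw [show 2 * (m + 1) = 2 * m + 2 by ring, sharpPoly_add_two]
    refine dvd_sub (Dvd.dvd.mul_right ?_ _) (Dvd.dvd.mul_left ih _)
    exact ⟨C b, by rw [← map_mul]⟩

/-- `v_{2m+1} ∈ 3·ℤ[T]` for `a = 3b` (`v_1 = 0`, same recursion). [cite: Sprung2017, Cor. 4.4] -/
theorem three_dvd_flatPoly_two_mul_add_one (b : ℤ) (m : ℕ) : (C 3 : ℤ[X]) ∣ flatPoly (3 * b) 3 (2 * m + 1) := by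
  induction m with
  | zero => simp
  | succ m ih =>
    rw [show 2 * (m + 1) + 1 = 2 * m + 1 + 2 by ring, flatPoly_add_two]
    refine dvd_sub (Dvd.dvd.mul_right ?_ _) (Dvd.dvd.mul_left ih _)
    exact ⟨C b, by rw [← map_mul]⟩

/-- `3 ∣ u_n·u_{n+1}` (one index is even). [cite: Sprung2017, Cor. 4.4] -/
theorem three_dvd_sharpPoly_mul_succ (b : ℤ) (n : ℕ) :
    (C 3 : ℤ[X]) ∣ sharpPoly (3 * b) 3 n * sharpPoly (3 * b) 3 (n + 1) := by
  obtain ⟨m, rfl | rfl⟩ := Nat.even_or_odd' n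
  · exact Dvd.dvd.mul_right (three_dvd_sharpPoly_two_mul b m) _
  · rw [show 2 * m + 1 + 1 = 2 * (m + 1) by ring]
    exact Dvd.dvd.mul_left (three_dvd_sharpPoly_two_mul b (m + 1)) _

/-- `3 ∣ v_n·v_{n+1}` (one index is odd). [cite: Sprung2017, Cor. 4.4] -/
theorem three_dvd_flatPoly_mul_succ (b : ℤ) (n : ℕ) :
    (C 3 : ℤ[X]) ∣ flatPoly (3 * b) 3 n * flatPoly (3 * b) 3 (n + 1) := by
  obtain ⟨m, rfl | rfl⟩ := Nat.even_or_odd' n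
  · exact Dvd.dvd.mul_left (three_dvd_flatPoly_two_mul_add_one b m) _
  · exact Dvd.dvd.mul_right (three_dvd_flatPoly_two_mul_add_one b m) _

end Parity

/-! ## §2 Twist matrices with the mod-3 / mod-T invariants -/

section Twist

variable {S : Type*} [CommRing S] (ψ : ℤ[X] →+* S) (σ : S →+* S) (b : ℤ)

/-- **The twist matrices, mod-3 refined.** As `exists_twistMatrix_rowSeq` at `a = 3b`, with the extra invariants
`3 ∣ M_{01}`, `3 ∣ M_{10}`, `M_{00}(0) = M_{11}(0) = 1` (the factors `E_{n+1}` are diagonal mod `3` and `≡ 1` mod `T`).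
[cite: Sprung2017, §3.4 Prop. 3.14 and Cor. 4.4] -/
theorem exists_twistMatrix_rowSeq_modThree (hC : σ (ψ (C (3 * b))) = ψ (C (3 * b)))
    (hΦ : ∀ m : ℕ, ∃ w : S, σ (ψ ((cyclotomic (3 ^ (m + 1)) ℤ).comp (X + 1))) =
        w * ψ ((cyclotomic (3 ^ (m + 1)) ℤ).comp (X + 1)) ∧ ψ ((X + 1) ^ (2 * 3 ^ m)) * w = 1)
    (n : ℕ) :
    ∃ M : Matrix (Fin 2) (Fin 2) ℤ[X], ((C 3 : ℤ[X]) ∣ M 0 1 ∧ (C 3 : ℤ[X]) ∣ M 1 0 ∧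
        (M 0 0).coeff 0 = 1 ∧ (M 1 1).coeff 0 = 1) ∧
      ∀ m : ℕ, (m = n + 1 ∨ m = n) → ∀ i : Fin 2,
        ψ (rowSeq (3 * b) 3 i m) =
          ψ (M i 0) * σ (ψ (rowSeq (3 * b) 3 0 m)) + ψ (M i 1) * σ (ψ (rowSeq (3 * b) 3 1 m)) := by
  induction n with
  | zero =>
    refine ⟨1, ⟨by simp, by simp, by simp, by simp⟩, fun m hm i => ?_⟩
    rcases hm with rfl | rfl <;> fin_cases i <;> simp [rowSeq, Matrix.one_apply]
  | succ n ih =>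
    obtain ⟨M, ⟨hM01, hM10, hM00, hM11⟩, hM⟩ := ih
    set a : ℤ := 3 * b with ha
    -- the factor `E_{n+1}`, `g = (1+T)^{3^n} + 1`
    set E : Matrix (Fin 2) (Fin 2) ℤ[X] :=
      !![1 - X * ((X + 1) ^ 3 ^ n + 1) * sharpPoly a 3 n * flatPoly a 3 (n + 1),
          X * ((X + 1) ^ 3 ^ n + 1) * sharpPoly a 3 n * sharpPoly a 3 (n + 1);
        -(X * ((X + 1) ^ 3 ^ n + 1) * flatPoly a 3 n * flatPoly a 3 (n + 1)),
          1 + X * ((X + 1) ^ 3 ^ n + 1) * flatPoly a 3 n * sharpPoly a 3 (n + 1)] with hEdef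
    have hE00 : E 0 0 = 1 - X * ((X + 1) ^ 3 ^ n + 1) * sharpPoly a 3 n * flatPoly a 3 (n + 1) := rfl
    have hE01 : E 0 1 = X * ((X + 1) ^ 3 ^ n + 1) * sharpPoly a 3 n * sharpPoly a 3 (n + 1) := rfl
    have hE10 : E 1 0 = -(X * ((X + 1) ^ 3 ^ n + 1) * flatPoly a 3 n * flatPoly a 3 (n + 1)) := rfl
    have hE11 : E 1 1 = 1 + X * ((X + 1) ^ 3 ^ n + 1) * flatPoly a 3 n * sharpPoly a 3 (n + 1) := rfl
    have hdet := X_mul_det_rowSeq a n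
    -- `E` fixes the column `x_{n+1}` …
    have hP1 : ∀ i : Fin 2, E i 0 * sharpPoly a 3 (n + 1) + E i 1 * flatPoly a 3 (n + 1) = rowSeq a 3 i (n + 1) := by
      intro i
      fin_cases i
      · simp only [Fin.zero_eta, Fin.isValue, hE00, hE01, rowSeq_zero]
        ring
      · simp only [Fin.mk_one, Fin.isValue, hE10, hE11, rowSeq_one]
        ring
    -- … and multiplies the column `x_n` by `(1+T)^{2·3^n}`
    have hP2 : ∀ i : Fin 2, E i 0 * sharpPoly a 3 n + E i 1 * flatPoly a 3 n =
        (X + 1) ^ (2 * 3 ^ n) * rowSeq a 3 i n := by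
      intro i
      fin_cases i
      · simp only [Fin.zero_eta, Fin.isValue, hE00, hE01, rowSeq_zero]
        linear_combination (((X + 1) ^ 3 ^ n + 1) * sharpPoly a 3 n) * hdet
      · simp only [Fin.mk_one, Fin.isValue, hE10, hE11, rowSeq_one]
        linear_combination (((X + 1) ^ 3 ^ n + 1) * flatPoly a 3 n) * hdet
    -- the identities of the induction hypothesis, both old columns, read on `u` and `v`
    have hU1 := hM (n + 1) (Or.inl rfl) 0
    have hV1 := hM (n + 1) (Or.inl rfl) 1
    have hU0 := hM n (Or.inr rfl) 0
    have hV0 := hM n (Or.inr rfl) 1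
    simp only [rowSeq_zero, rowSeq_one] at hU1 hV1 hU0 hV0
    have hEM' : ∀ i l : Fin 2, (E * M) i l = E i 0 * M 0 l + E i 1 * M 1 l := fun i l => by
      rw [Matrix.mul_apply, Fin.sum_univ_two]
    have hE01dvd : (C 3 : ℤ[X]) ∣ E 0 1 := by
      rw [hE01, mul_assoc]
      exact Dvd.dvd.mul_left (three_dvd_sharpPoly_mul_succ b n) _
    have hE10dvd : (C 3 : ℤ[X]) ∣ E 1 0 := by
      rw [hE10, mul_assoc]
      exact (Dvd.dvd.mul_left (three_dvd_flatPoly_mul_succ b n) _).neg_right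
    have hinv : (C 3 : ℤ[X]) ∣ (E * M) 0 1 ∧ (C 3 : ℤ[X]) ∣ (E * M) 1 0 ∧
        ((E * M) 0 0).coeff 0 = 1 ∧ ((E * M) 1 1).coeff 0 = 1 := by
      refine ⟨?_, ?_, ?_, ?_⟩
      · rw [hEM']
        exact dvd_add (Dvd.dvd.mul_left hM01 _) (Dvd.dvd.mul_right hE01dvd _)
      · rw [hEM']
        exact dvd_add (Dvd.dvd.mul_right hE10dvd _) (Dvd.dvd.mul_left hM10 _)
      · rw [hEM', coeff_add, mul_coeff_zero, mul_coeff_zero, hM00, hE00, hE01]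
        simp
      · rw [hEM', coeff_add, mul_coeff_zero, mul_coeff_zero, hM11, hE10, hE11]
        simp
    refine ⟨E * M, hinv, fun m hm i => ?_⟩
    have hEM : ∀ l : Fin 2, (E * M) i l = E i 0 * M 0 l + E i 1 * M 1 l := fun l => by
      rw [Matrix.mul_apply, Fin.sum_univ_two]
    have hP1i := congrArg ψ (hP1 i)
    have hP2i := congrArg ψ (hP2 i)
    simp only [map_add, map_mul] at hP1i hP2i
    rw [rowSeq_zero, rowSeq_one, hEM 0, hEM 1]
    simp only [map_add, map_mul]
    rcases hm with rfl | rfl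
    · -- the NEW column `x_{n+2} = a·x_{n+1} − Φ·x_n`
      obtain ⟨w, hw, hw1⟩ := hΦ n
      have hrow : rowSeq a 3 i (n + 1 + 1) =
          C a * rowSeq a 3 i (n + 1) - (cyclotomic (3 ^ (n + 1)) ℤ).comp (X + 1) * rowSeq a 3 i n := by
        fin_cases i
        · exact sharpPoly_add_two a 3 n
        · exact flatPoly_add_two a 3 n
      rw [hrow, sharpPoly_add_two, flatPoly_add_two]
      simp only [map_sub, map_mul, hC, hw]
      linear_combination (ψ (C a) * ψ (E i 0)) * hU1 + (ψ (C a) * ψ (E i 1)) * hV1 +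
        (-(w * ψ ((cyclotomic (3 ^ (n + 1)) ℤ).comp (X + 1)) * ψ (E i 0))) * hU0 +
        (-(w * ψ ((cyclotomic (3 ^ (n + 1)) ℤ).comp (X + 1)) * ψ (E i 1))) * hV0 +
        (-ψ (C a)) * hP1i + (w * ψ ((cyclotomic (3 ^ (n + 1)) ℤ).comp (X + 1))) * hP2i +
        (ψ ((cyclotomic (3 ^ (n + 1)) ℤ).comp (X + 1)) * ψ (rowSeq a 3 i n)) * hw1
    · -- the column `x_{n+1}` is fixed by `E`
      linear_combination ψ (E i 0) * hU1 + ψ (E i 1) * hV1 + (-1 : S) * hP1i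


end Twist

/-! ## §3 The approximants with invariants -/

section Approximants

/-- An integer polynomial read in `ℚ_3⟦T⟧` through `Λ` is its image through `ℚ` (private plumbing). [folklore] -/
private theorem coe_map_map_eq' (q : ℤ[X]) :
    (((q.map (Int.castRingHom ℚ)).map (algebraMap ℚ ℚ_[3]) : ℚ_[3][X]) : PowerSeries ℚ_[3]) =
      (iwasawaToPowerSeries 3).comp (toIwasawa 3) q := by
  rw [RingHom.comp_apply]
  change _ = PowerSeries.map (algebraMap ℤ_[3] ℚ_[3])
    (((q.map (Int.castRingHom ℤ_[3])) : ℤ_[3][X]) : PowerSeries ℤ_[3])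
  rw [← Polynomial.polynomial_map_coe, Polynomial.map_map, Polynomial.map_map,
    RingHom.ext_int ((algebraMap ℤ_[3] ℚ_[3]).comp (Int.castRingHom ℤ_[3]))
      ((algebraMap ℚ ℚ_[3]).comp (Int.castRingHom ℚ))]

/-- The image of `T + 1` (private plumbing). [folklore] -/
private theorem psi_X_add_one' :
    (iwasawaToPowerSeries 3).comp (toIwasawa 3) (X + 1) = PowerSeries.X + 1 := by
  rw [← coe_map_map_eq']
  simp

/-- The image of a constant (private plumbing). [folklore] -/
private theorem psi_C' (c : ℤ) :
    (iwasawaToPowerSeries 3).comp (toIwasawa 3) (C c) = PowerSeries.C (c : ℚ_[3]) := by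
  rw [← coe_map_map_eq', Polynomial.map_C, Polynomial.map_C, Polynomial.coe_C, eq_intCast, eq_ratCast,
    Rat.cast_intCast]

variable (b : ℤ)

/-- The entries of `A_n` read in `ℚ_3⟦T⟧` (private plumbing). [cite: Sprung2017, §3.1] -/
private theorem coe_map_halfLogApprox_eq' (n : ℕ) (i k : Fin 2) :
    (((halfLogApprox 3 (3 * b) n i k).map (algebraMap ℚ ℚ_[3]) : ℚ_[3][X]) : PowerSeries ℚ_[3]) =
      (iwasawaToPowerSeries 3).comp (toIwasawa 3) (rowSeq (3 * b) 3 i (n + 1)) *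
          PowerSeries.C ((((sprungCinv 3 (3 * b)) ^ (n + 2)) 0 k : ℚ) : ℚ_[3]) +
        (iwasawaToPowerSeries 3).comp (toIwasawa 3) (rowSeq (3 * b) 3 i n) *
          PowerSeries.C ((((sprungCinv 3 (3 * b)) ^ (n + 2)) 1 k : ℚ) : ℚ_[3]) := by
  simp only [halfLogApprox, Polynomial.map_add, Polynomial.map_mul, Polynomial.map_C, Polynomial.coe_add,
    Polynomial.coe_mul, Polynomial.coe_C, coe_map_map_eq', eq_ratCast]

/-- **`A_n = M_n·A_n(T^ι)`** with the mod-3-refined twist matrix. [cite: Sprung2017, §3.4 Prop. 3.14 and §3.1] -/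
theorem exists_twistMatrix_halfLogApprox_modThree (n : ℕ) :
    ∃ M : Matrix (Fin 2) (Fin 2) ℤ[X], ((C 3 : ℤ[X]) ∣ M 0 1 ∧ (C 3 : ℤ[X]) ∣ M 1 0 ∧
        (M 0 0).coeff 0 = 1 ∧ (M 1 1).coeff 0 = 1) ∧ ∀ i k : Fin 2,
      (((halfLogApprox 3 (3 * b) n i k).map (algebraMap ℚ ℚ_[3]) : ℚ_[3][X]) : PowerSeries ℚ_[3]) =
        iwasawaToPowerSeries 3 (toIwasawa 3 (M i 0)) *
            PowerSeries.subst (invOnePlusSubOne : PowerSeries ℚ_[3])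
              (((halfLogApprox 3 (3 * b) n 0 k).map (algebraMap ℚ ℚ_[3]) : ℚ_[3][X]) : PowerSeries ℚ_[3]) +
          iwasawaToPowerSeries 3 (toIwasawa 3 (M i 1)) *
            PowerSeries.subst (invOnePlusSubOne : PowerSeries ℚ_[3])
              (((halfLogApprox 3 (3 * b) n 1 k).map (algebraMap ℚ ℚ_[3]) : ℚ_[3][X]) : PowerSeries ℚ_[3]) := by
  have hι := hasSubst_invOnePlusSubOne (R := ℚ_[3])
  set ψ : ℤ[X] →+* PowerSeries ℚ_[3] := (iwasawaToPowerSeries 3).comp (toIwasawa 3) with hψ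
  set σ : PowerSeries ℚ_[3] →+* PowerSeries ℚ_[3] := (PowerSeries.substAlgHom hι).toRingHom with hσ
  have hσapp : ∀ x : PowerSeries ℚ_[3], σ x = PowerSeries.subst (invOnePlusSubOne : PowerSeries ℚ_[3]) x :=
    fun x => by rw [hσ, AlgHom.toRingHom_eq_coe, RingHom.coe_coe, PowerSeries.coe_substAlgHom]
  have hC : σ (ψ (C (3 * b))) = ψ (C (3 * b)) := by
    rw [hψ, psi_C', PowerSeries.C_eq_algebraMap, hσ, AlgHom.toRingHom_eq_coe, RingHom.coe_coe, AlgHom.commutes]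
  have hΦ : ∀ m : ℕ, ∃ w : PowerSeries ℚ_[3], σ (ψ ((cyclotomic (3 ^ (m + 1)) ℤ).comp (X + 1))) =
      w * ψ ((cyclotomic (3 ^ (m + 1)) ℤ).comp (X + 1)) ∧ ψ ((X + 1) ^ (2 * 3 ^ m)) * w = 1 := by
    intro m
    refine ⟨(invOnePlusSubOne + 1 : PowerSeries ℚ_[3]) ^ (2 * 3 ^ m), ?_, ?_⟩
    · have hq : ψ ((cyclotomic (3 ^ (m + 1)) ℤ).comp (X + 1)) =
          (1 + PowerSeries.X : PowerSeries ℚ_[3]) ^ (2 * 3 ^ m) + (1 + PowerSeries.X) ^ 3 ^ m + 1 := by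
        rw [cyclotomic_three_pow_succ_comp, map_add, map_add, map_pow, map_pow, map_one, hψ, psi_X_add_one',
          add_comm PowerSeries.X 1]
      rw [hq, hσapp, subst_invOnePlusSubOne_cyclotomicFactor]
    · have hE : (1 + PowerSeries.X : PowerSeries ℚ_[3]) * (invOnePlusSubOne + 1) = 1 :=
        one_add_X_mul_invOnePlusSubOne_add_one
      rw [map_pow, hψ, psi_X_add_one', add_comm PowerSeries.X 1, ← mul_pow, hE, one_pow]
  obtain ⟨M, hinv, hM⟩ := exists_twistMatrix_rowSeq_modThree ψ σ b hC hΦ n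
  refine ⟨M, hinv, fun i k => ?_⟩
  have e1 := hM (n + 1) (Or.inl rfl) i
  have e0 := hM n (Or.inr rfl) i
  rw [coe_map_halfLogApprox_eq', coe_map_halfLogApprox_eq', coe_map_halfLogApprox_eq', ← hψ, ← hσapp, ← hσapp]
  simp only [map_add, map_mul]
  have hc0 : σ (PowerSeries.C ((((sprungCinv 3 (3 * b)) ^ (n + 2)) 0 k : ℚ) : ℚ_[3])) =
      PowerSeries.C ((((sprungCinv 3 (3 * b)) ^ (n + 2)) 0 k : ℚ) : ℚ_[3]) := by
    rw [PowerSeries.C_eq_algebraMap, hσ, AlgHom.toRingHom_eq_coe, RingHom.coe_coe, AlgHom.commutes]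
  have hc1 : σ (PowerSeries.C ((((sprungCinv 3 (3 * b)) ^ (n + 2)) 1 k : ℚ) : ℚ_[3])) =
      PowerSeries.C ((((sprungCinv 3 (3 * b)) ^ (n + 2)) 1 k : ℚ) : ℚ_[3]) := by
    rw [PowerSeries.C_eq_algebraMap, hσ, AlgHom.toRingHom_eq_coe, RingHom.coe_coe, AlgHom.commutes]
  rw [hc0, hc1]
  linear_combination (PowerSeries.C ((((sprungCinv 3 (3 * b)) ^ (n + 2)) 0 k : ℚ) : ℚ_[3])) * e1 +
    (PowerSeries.C ((((sprungCinv 3 (3 * b)) ^ (n + 2)) 1 k : ℚ) : ℚ_[3])) * e0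

end Approximants

/-! ## §4 The limit with invariants -/

section Limit

/-- `[T^e] G(ι)` as a finite sum (private plumbing). [folklore] -/
private theorem coeff_subst_invOnePlusSubOne_eq_sum' (G : PowerSeries ℚ_[3]) (e : ℕ) :
    PowerSeries.coeff e (PowerSeries.subst (invOnePlusSubOne : PowerSeries ℚ_[3]) G) =
      ∑ d ∈ Finset.range (e + 1), PowerSeries.coeff d G *
        PowerSeries.coeff e ((invOnePlusSubOne : PowerSeries ℚ_[3]) ^ d) := by
  have h0 : PowerSeries.constantCoeff (invOnePlusSubOne : PowerSeries ℚ_[3]) = 0 := constantCoeff_invOnePlusSubOne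
  rw [PowerSeries.coeff_subst' (PowerSeries.HasSubst.of_constantCoeff_zero' h0),
    finsum_eq_sum_of_support_subset _ (s := Finset.range (e + 1)) ?_]
  · simp only [smul_eq_mul]
  · intro d hd
    simp only [Function.mem_support, ne_eq, Finset.coe_range, Set.mem_Iio] at hd ⊢
    by_contra hlt
    apply hd
    rw [PowerSeries.coeff_of_lt_order e (lt_of_lt_of_le (by exact_mod_cast (by omega : e < d))
      (natCast_le_order_pow h0 d)), smul_zero]

/-- The integers divisible by `3` form a closed subset of `ℤ_3` (private plumbing). [folklore] -/
private theorem isClosed_three_dvd : IsClosed {x : ℤ_[3] | (3 : ℤ_[3]) ∣ x} := by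
  have h : {x : ℤ_[3] | (3 : ℤ_[3]) ∣ x} = Metric.ball (0 : ℤ_[3]) 1 := by
    ext x
    rw [Set.mem_setOf_eq, mem_ball_zero_iff]
    have := PadicInt.norm_lt_one_iff_dvd x
    exact_mod_cast this.symm
  rw [h]
  exact IsUltrametricDist.isClosed_ball 0 1

/-- **`ℒ(T) = M(T)·ℒ(T^ι)` with `M ∈ M₂(ℤ_3⟦T⟧)` DIAGONAL MOD 3 and `≡ 1` MOD `T`.** As
`exists_integral_halfLogMatrix_eq_mul_subst`, with in addition: every coefficient of `M_{01}` and of `M_{10}` is divisible by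
`3`, and `M_{00}(0) = M_{11}(0) = 1`. [cite: Sprung2017, §3.4 Prop. 3.14, Cor. 4.4 and Cor. 4.6] [cite: GreenbergLNM1716, §1] -/
theorem exists_integral_halfLogMatrix_eq_mul_subst_modThree (b : ℤ) :
    ∃ M : Matrix (Fin 2) (Fin 2) (PowerSeries ℤ_[3]),
      (∀ j, (3 : ℤ_[3]) ∣ PowerSeries.coeff j (M 0 1)) ∧ (∀ j, (3 : ℤ_[3]) ∣ PowerSeries.coeff j (M 1 0)) ∧
      PowerSeries.constantCoeff (M 0 0) = 1 ∧ PowerSeries.constantCoeff (M 1 1) = 1 ∧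
      ∀ i k : Fin 2, halfLogMatrix b i k =
        iwasawaToPowerSeries 3 (M i 0) *
            PowerSeries.subst (invOnePlusSubOne : PowerSeries ℚ_[3]) (halfLogMatrix b 0 k) +
          iwasawaToPowerSeries 3 (M i 1) *
            PowerSeries.subst (invOnePlusSubOne : PowerSeries ℚ_[3]) (halfLogMatrix b 1 k) := by
  classical
  choose Mn hinv hMn using exists_twistMatrix_halfLogApprox_modThree b
  let s : ℕ → (Fin 2 → Fin 2 → ℕ → ℤ_[3]) := fun n i l j => (((Mn n i l).coeff j : ℤ) : ℤ_[3])
  obtain ⟨a, φ, hφ, ha⟩ := SeqCompactSpace.tendsto_subseq s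
  have haZ : ∀ (i l : Fin 2) (j : ℕ), Tendsto (fun n => s (φ n) i l j) atTop (𝓝 (a i l j)) := fun i l j =>
    tendsto_pi_nhds.mp (tendsto_pi_nhds.mp (tendsto_pi_nhds.mp ha i) l) j
  have ha' : ∀ (i l : Fin 2) (j : ℕ),
      Tendsto (fun n => (((Mn (φ n) i l).coeff j : ℤ) : ℚ_[3])) atTop (𝓝 ((a i l j : ℤ_[3]) : ℚ_[3])) := by
    intro i l j
    have h4 := (continuous_subtype_val.tendsto (a i l j)).comp (haZ i l j)
    refine h4.congr fun n => ?_
    simp [s, Function.comp]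
  -- the invariants pass to the limit
  have hoff : ∀ (i l : Fin 2), (∀ n, (C 3 : ℤ[X]) ∣ Mn n i l) → ∀ j, (3 : ℤ_[3]) ∣ a i l j := by
    intro i l hn j
    have hmem : ∀ n, s (φ n) i l j ∈ {x : ℤ_[3] | (3 : ℤ_[3]) ∣ x} := by
      intro n
      obtain ⟨q, hq⟩ := hn (φ n)
      simp only [Set.mem_setOf_eq, s, hq, coeff_C_mul]
      push_cast
      exact Dvd.intro _ rfl
    exact isClosed_three_dvd.mem_of_tendsto (haZ i l j) (Filter.Eventually.of_forall hmem)
  have hdiag : ∀ (i : Fin 2), (∀ n, (Mn n i i).coeff 0 = 1) → a i i 0 = 1 := by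
    intro i hn
    have hconst : Tendsto (fun n => s (φ n) i i 0) atTop (𝓝 1) := by
      have : (fun n => s (φ n) i i 0) = fun _ => 1 := by
        funext n
        simp [s, hn (φ n)]
      rw [this]
      exact tendsto_const_nhds
    exact tendsto_nhds_unique (haZ i i 0) hconst
  refine ⟨fun i l => PowerSeries.mk (a i l), ?_, ?_, ?_, ?_, fun i k => ?_⟩
  · intro j
    rw [PowerSeries.coeff_mk]
    exact hoff 0 1 (fun n => (hinv n).1) j
  · intro j
    rw [PowerSeries.coeff_mk]
    exact hoff 1 0 (fun n => (hinv n).2.1) j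
  · rw [← PowerSeries.coeff_zero_eq_constantCoeff_apply, PowerSeries.coeff_mk]
    exact hdiag 0 (fun n => (hinv n).2.2.1)
  · rw [← PowerSeries.coeff_zero_eq_constantCoeff_apply, PowerSeries.coeff_mk]
    exact hdiag 1 (fun n => (hinv n).2.2.2)
  ext j
  let T : (ℕ → ℚ_[3]) → (ℕ → ℚ_[3]) → ℚ_[3] := fun f g =>
    ∑ x ∈ Finset.HasAntidiagonal.antidiagonal j, f x.1 *
      ∑ d ∈ Finset.range (x.2 + 1), g d * PowerSeries.coeff x.2 ((invOnePlusSubOne : PowerSeries ℚ_[3]) ^ d)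
  have hT : ∀ F G : PowerSeries ℚ_[3],
      PowerSeries.coeff j (F * PowerSeries.subst (invOnePlusSubOne : PowerSeries ℚ_[3]) G) =
        T (fun d => PowerSeries.coeff d F) (fun d => PowerSeries.coeff d G) := by
    intro F G
    simp only [T, PowerSeries.coeff_mul, coeff_subst_invOnePlusSubOne_eq_sum']
  have hTlim : ∀ {f g : ℕ → ℕ → ℚ_[3]} {f₀ g₀ : ℕ → ℚ_[3]},
      (∀ d, Tendsto (fun n => f n d) atTop (𝓝 (f₀ d))) → (∀ d, Tendsto (fun n => g n d) atTop (𝓝 (g₀ d))) →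
        Tendsto (fun n => T (f n) (g n)) atTop (𝓝 (T f₀ g₀)) := by
    intro f g f₀ g₀ hf hg
    exact tendsto_finsetSum _ fun x _ =>
      (hf x.1).mul (tendsto_finsetSum _ fun d _ => (hg d).mul_const _)
  have hcM : ∀ (n : ℕ) (i l : Fin 2) (d : ℕ),
      PowerSeries.coeff d (iwasawaToPowerSeries 3 (toIwasawa 3 (Mn n i l))) = (((Mn n i l).coeff d : ℤ) : ℚ_[3]) := by
    intro n i l d
    change PowerSeries.coeff d (PowerSeries.map (algebraMap ℤ_[3] ℚ_[3])
      ((((Mn n i l).map (Int.castRingHom ℤ_[3])) : ℤ_[3][X]) : PowerSeries ℤ_[3])) = _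
    rw [PowerSeries.coeff_map, Polynomial.coeff_coe, Polynomial.coeff_map]
    simp
  have hcMlim : ∀ (i l : Fin 2) (d : ℕ),
      PowerSeries.coeff d (iwasawaToPowerSeries 3 (PowerSeries.mk (a i l))) = ((a i l d : ℤ_[3]) : ℚ_[3]) := by
    intro i l d
    rw [PowerSeries.coeff_map, PowerSeries.coeff_mk]
    rfl
  have hlhs : Tendsto (fun n => coeffSeq b (φ n) i k j) atTop (𝓝 (PowerSeries.coeff j (halfLogMatrix b i k))) :=
    (tendsto_coeffSeq b i k j).comp hφ.tendsto_atTop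
  have heq : ∀ n : ℕ, coeffSeq b (φ n) i k j =
      T (fun d => (((Mn (φ n) i 0).coeff d : ℤ) : ℚ_[3])) (fun d => coeffSeq b (φ n) 0 k d) +
        T (fun d => (((Mn (φ n) i 1).coeff d : ℤ) : ℚ_[3])) (fun d => coeffSeq b (φ n) 1 k d) := by
    intro n
    have h := congrArg (PowerSeries.coeff j) (hMn (φ n) i k)
    rw [coeff_coe_map_halfLogApprox, map_add, hT, hT] at h
    simp only [hcM, coeff_coe_map_halfLogApprox] at h
    exact h
  have hrhs : Tendsto (fun n => coeffSeq b (φ n) i k j) atTop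
      (𝓝 (T (fun d => ((a i 0 d : ℤ_[3]) : ℚ_[3])) (fun d => PowerSeries.coeff d (halfLogMatrix b 0 k)) +
        T (fun d => ((a i 1 d : ℤ_[3]) : ℚ_[3])) (fun d => PowerSeries.coeff d (halfLogMatrix b 1 k)))) := by
    simp_rw [heq]
    exact (hTlim (ha' i 0) fun d => (tendsto_coeffSeq b 0 k d).comp hφ.tendsto_atTop).add
      (hTlim (ha' i 1) fun d => (tendsto_coeffSeq b 1 k d).comp hφ.tendsto_atTop)
  have hlim := tendsto_nhds_unique hlhs hrhs
  rw [hlim, map_add, hT, hT]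
  simp only [hcMlim]

end Limit

end Literature.NumberTheory.EllipticCurves.Sprung2017

end
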